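import Summits.ABC.ABC.Theorems.TwistAmplificationMazurKaneLawRecordLPDEAdapter

/-!
# Crux `TwistAmplification.MazurKaneLaw` (stmt-ABC-2757), line `critical-kloosterman-powerful-moduli`: the POINTWISE adapter from the
# bundle `LpHypsDE4` to the generic LP statement `LpCertDE K 4 s₀ Vc`

`lpCertDE_of_lpHypsDE4` (`…RecordLPDEAdapter.lean`) is tied to the plateau certificate (`K = 3`, `Vc = (2+s₀)/4`, `16/9 ≤ s₀ ≤ 2`). This file
states the same conversion at an arbitrary point `(K, s₀, Vc)`, so that every further `J = 4` certificate in bundle form (e.g. `lp_DE2` on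
`[5/3, 16/9]`) feeds the DE dictionary without a new adapter. The proof is verbatim the same (27 structural hypotheses up to the cast
`((4 : ℕ) : ℝ) = 4`; 21 × 8 `linarith` conversions of the DE rows), reusing the `Finset`-sum lemmas `de_sumQ*` and `de_fin4_casts`.
-/

-- `Summit.<Summit>.<Problem>`: the duplicate `ABC.ABC` is deliberate (single-conjunct summit).
set_option linter.dupNamespace false

open Finset

namespace Summit.ABC.ABC.Theorems.MazurKaneLaw

set_option maxHeartbeats 400000 in
/-- **Pointwise adapter** (registered sub-goal `lpCertDE_of_lpHypsDE4_at` of crux stmt-ABC-2757): at fixed `(K, s₀, Vc)`, a proof of the LP in the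
bundle form `LpHypsDE4 s₀ … → D ≤ Vc + K σ` (as every generated `J = 4` certificate provides on its range) gives the generic LP statement
`LpCertDE K 4 s₀ Vc`. Same proof as `lpCertDE_of_lpHypsDE4` (which is the case `K = 3`, `Vc = (2+s₀)/4` under `16/9 ≤ s₀ ≤ 2`). [folklore] -/
theorem lpCertDE_of_lpHypsDE4_at : ∀ (K s₀ Vc : ℝ), (∀ (a b c : Fin 4 → ℝ) (A B C D da db dc σ : ℝ), Summit.ABC.ABC.Theorems.MazurKaneLaw.Toolkit.LpHypsDE4 s₀ a b c A B C D da db dc σ → D ≤ Vc + K * σ) → Summit.ABC.ABC.Theorems.MazurKaneLaw.Toolkit.LpCertDE K 4 s₀ Vc := by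
  intro K s₀ Vc hlp a b c A B C D da db dc σ ha hb hc hTa0 hTb0 hTc0 hWa' hda0 hda1 hWb' hdb0 hdb1 hWc' hdc0 hdcs hs0 hsm hL hT_ab hT_ac hT_bc hDt hF hG hQa hQb hQc hDEa hDEb hDEc
  have hWa0 : ((4 : ℝ) + 1) * A - ∑ k : Fin 4, ((4 : ℝ) - ((k : ℕ) : ℝ)) * a k ≤ 1 - da := by simpa only [Nat.cast_ofNat] using hWa'
  have hWb0 : ((4 : ℝ) + 1) * B - ∑ k : Fin 4, ((4 : ℝ) - ((k : ℕ) : ℝ)) * b k ≤ 1 - db := by simpa only [Nat.cast_ofNat] using hWb'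
  have hWc0 : ((4 : ℝ) + 1) * C - ∑ k : Fin 4, ((4 : ℝ) - ((k : ℕ) : ℝ)) * c k ≤ 1 - dc := by simpa only [Nat.cast_ofNat] using hWc'
  obtain ⟨-, hv1, hv2, hv3⟩ := de_fin4_casts
  refine hlp a b c A B C D da db dc σ ⟨ha, hb, hc, hTa0, hTb0, hTc0, hWa0, hda0, hda1, hWb0, hdb0, hdb1, hWc0, hdc0, hdcs, hs0, hsm, hL, hT_ab, hT_ac, hT_bc, hDt, hF, hG, hQa, hQb, hQc, ?_, ?_, ?_, ?_, ?_, ?_, ?_, ?_, ?_, ?_, ?_, ?_, ?_, ?_, ?_, ?_, ?_, ?_, ?_, ?_, ?_⟩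
  · -- host a, Q = {1}
    have h := hDEa 0 1 rfl rfl {1}
    simp only [de_sumQ1, hv1] at h
    rcases h with h | h | h | h | h | h | h | h
    · exact Or.inl (by linarith only [h])
    · exact Or.inr (Or.inr (Or.inl (by linarith only [h])))
    · exact Or.inr (Or.inr (Or.inr (Or.inr (Or.inl (by linarith only [h])))))
    · exact Or.inr (Or.inr (Or.inr (Or.inr (Or.inr (Or.inr (Or.inl (by linarith only [h])))))))
    · exact Or.inr (Or.inl (by linarith only [h]))
    · exact Or.inr (Or.inr (Or.inr (Or.inl (by linarith only [h]))))
    · exact Or.inr (Or.inr (Or.inr (Or.inr (Or.inr (Or.inl (by linarith only [h]))))))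
    · exact Or.inr (Or.inr (Or.inr (Or.inr (Or.inr (Or.inr (Or.inr (by linarith only [h])))))))
  · -- host a, Q = {2}
    have h := hDEa 0 1 rfl rfl {2}
    simp only [de_sumQ2, hv2] at h
    rcases h with h | h | h | h | h | h | h | h
    · exact Or.inl (by linarith only [h])
    · exact Or.inr (Or.inr (Or.inl (by linarith only [h])))
    · exact Or.inr (Or.inr (Or.inr (Or.inr (Or.inl (by linarith only [h])))))
    · exact Or.inr (Or.inr (Or.inr (Or.inr (Or.inr (Or.inr (Or.inl (by linarith only [h])))))))
    · exact Or.inr (Or.inl (by linarith only [h]))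
    · exact Or.inr (Or.inr (Or.inr (Or.inl (by linarith only [h]))))
    · exact Or.inr (Or.inr (Or.inr (Or.inr (Or.inr (Or.inl (by linarith only [h]))))))
    · exact Or.inr (Or.inr (Or.inr (Or.inr (Or.inr (Or.inr (Or.inr (by linarith only [h])))))))
  · -- host a, Q = {3}
    have h := hDEa 0 1 rfl rfl {3}
    simp only [de_sumQ3, hv3] at h
    rcases h with h | h | h | h | h | h | h | h
    · exact Or.inl (by linarith only [h])
    · exact Or.inr (Or.inr (Or.inl (by linarith only [h])))
    · exact Or.inr (Or.inr (Or.inr (Or.inr (Or.inl (by linarith only [h])))))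
    · exact Or.inr (Or.inr (Or.inr (Or.inr (Or.inr (Or.inr (Or.inl (by linarith only [h])))))))
    · exact Or.inr (Or.inl (by linarith only [h]))
    · exact Or.inr (Or.inr (Or.inr (Or.inl (by linarith only [h]))))
    · exact Or.inr (Or.inr (Or.inr (Or.inr (Or.inr (Or.inl (by linarith only [h]))))))
    · exact Or.inr (Or.inr (Or.inr (Or.inr (Or.inr (Or.inr (Or.inr (by linarith only [h])))))))
  · -- host a, Q = {1, 2}
    have h := hDEa 0 1 rfl rfl {1, 2}
    simp only [de_sumQ12, hv1, hv2] at h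
    rcases h with h | h | h | h | h | h | h | h
    · exact Or.inl (by linarith only [h])
    · exact Or.inr (Or.inr (Or.inl (by linarith only [h])))
    · exact Or.inr (Or.inr (Or.inr (Or.inr (Or.inl (by linarith only [h])))))
    · exact Or.inr (Or.inr (Or.inr (Or.inr (Or.inr (Or.inr (Or.inl (by linarith only [h])))))))
    · exact Or.inr (Or.inl (by linarith only [h]))
    · exact Or.inr (Or.inr (Or.inr (Or.inl (by linarith only [h]))))
    · exact Or.inr (Or.inr (Or.inr (Or.inr (Or.inr (Or.inl (by linarith only [h]))))))
    · exact Or.inr (Or.inr (Or.inr (Or.inr (Or.inr (Or.inr (Or.inr (by linarith only [h])))))))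
  · -- host a, Q = {1, 3}
    have h := hDEa 0 1 rfl rfl {1, 3}
    simp only [de_sumQ13, hv1, hv3] at h
    rcases h with h | h | h | h | h | h | h | h
    · exact Or.inl (by linarith only [h])
    · exact Or.inr (Or.inr (Or.inl (by linarith only [h])))
    · exact Or.inr (Or.inr (Or.inr (Or.inr (Or.inl (by linarith only [h])))))
    · exact Or.inr (Or.inr (Or.inr (Or.inr (Or.inr (Or.inr (Or.inl (by linarith only [h])))))))
    · exact Or.inr (Or.inl (by linarith only [h]))
    · exact Or.inr (Or.inr (Or.inr (Or.inl (by linarith only [h]))))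
    · exact Or.inr (Or.inr (Or.inr (Or.inr (Or.inr (Or.inl (by linarith only [h]))))))
    · exact Or.inr (Or.inr (Or.inr (Or.inr (Or.inr (Or.inr (Or.inr (by linarith only [h])))))))
  · -- host a, Q = {2, 3}
    have h := hDEa 0 1 rfl rfl {2, 3}
    simp only [de_sumQ23, hv2, hv3] at h
    rcases h with h | h | h | h | h | h | h | h
    · exact Or.inl (by linarith only [h])
    · exact Or.inr (Or.inr (Or.inl (by linarith only [h])))
    · exact Or.inr (Or.inr (Or.inr (Or.inr (Or.inl (by linarith only [h])))))
    · exact Or.inr (Or.inr (Or.inr (Or.inr (Or.inr (Or.inr (Or.inl (by linarith only [h])))))))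
    · exact Or.inr (Or.inl (by linarith only [h]))
    · exact Or.inr (Or.inr (Or.inr (Or.inl (by linarith only [h]))))
    · exact Or.inr (Or.inr (Or.inr (Or.inr (Or.inr (Or.inl (by linarith only [h]))))))
    · exact Or.inr (Or.inr (Or.inr (Or.inr (Or.inr (Or.inr (Or.inr (by linarith only [h])))))))
  · -- host a, Q = {1, 2, 3}
    have h := hDEa 0 1 rfl rfl {1, 2, 3}
    simp only [de_sumQ123, hv1, hv2, hv3] at h
    rcases h with h | h | h | h | h | h | h | h
    · exact Or.inl (by linarith only [h])
    · exact Or.inr (Or.inr (Or.inl (by linarith only [h])))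
    · exact Or.inr (Or.inr (Or.inr (Or.inr (Or.inl (by linarith only [h])))))
    · exact Or.inr (Or.inr (Or.inr (Or.inr (Or.inr (Or.inr (Or.inl (by linarith only [h])))))))
    · exact Or.inr (Or.inl (by linarith only [h]))
    · exact Or.inr (Or.inr (Or.inr (Or.inl (by linarith only [h]))))
    · exact Or.inr (Or.inr (Or.inr (Or.inr (Or.inr (Or.inl (by linarith only [h]))))))
    · exact Or.inr (Or.inr (Or.inr (Or.inr (Or.inr (Or.inr (Or.inr (by linarith only [h])))))))
  · -- host b, Q = {1}
    have h := hDEb 0 1 rfl rfl {1}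
    simp only [de_sumQ1, hv1] at h
    rcases h with h | h | h | h | h | h | h | h
    · exact Or.inl (by linarith only [h])
    · exact Or.inr (Or.inr (Or.inl (by linarith only [h])))
    · exact Or.inr (Or.inr (Or.inr (Or.inr (Or.inl (by linarith only [h])))))
    · exact Or.inr (Or.inr (Or.inr (Or.inr (Or.inr (Or.inr (Or.inl (by linarith only [h])))))))
    · exact Or.inr (Or.inl (by linarith only [h]))
    · exact Or.inr (Or.inr (Or.inr (Or.inl (by linarith only [h]))))
    · exact Or.inr (Or.inr (Or.inr (Or.inr (Or.inr (Or.inl (by linarith only [h]))))))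
    · exact Or.inr (Or.inr (Or.inr (Or.inr (Or.inr (Or.inr (Or.inr (by linarith only [h])))))))
  · -- host b, Q = {2}
    have h := hDEb 0 1 rfl rfl {2}
    simp only [de_sumQ2, hv2] at h
    rcases h with h | h | h | h | h | h | h | h
    · exact Or.inl (by linarith only [h])
    · exact Or.inr (Or.inr (Or.inl (by linarith only [h])))
    · exact Or.inr (Or.inr (Or.inr (Or.inr (Or.inl (by linarith only [h])))))
    · exact Or.inr (Or.inr (Or.inr (Or.inr (Or.inr (Or.inr (Or.inl (by linarith only [h])))))))
    · exact Or.inr (Or.inl (by linarith only [h]))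
    · exact Or.inr (Or.inr (Or.inr (Or.inl (by linarith only [h]))))
    · exact Or.inr (Or.inr (Or.inr (Or.inr (Or.inr (Or.inl (by linarith only [h]))))))
    · exact Or.inr (Or.inr (Or.inr (Or.inr (Or.inr (Or.inr (Or.inr (by linarith only [h])))))))
  · -- host b, Q = {3}
    have h := hDEb 0 1 rfl rfl {3}
    simp only [de_sumQ3, hv3] at h
    rcases h with h | h | h | h | h | h | h | h
    · exact Or.inl (by linarith only [h])
    · exact Or.inr (Or.inr (Or.inl (by linarith only [h])))
    · exact Or.inr (Or.inr (Or.inr (Or.inr (Or.inl (by linarith only [h])))))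
    · exact Or.inr (Or.inr (Or.inr (Or.inr (Or.inr (Or.inr (Or.inl (by linarith only [h])))))))
    · exact Or.inr (Or.inl (by linarith only [h]))
    · exact Or.inr (Or.inr (Or.inr (Or.inl (by linarith only [h]))))
    · exact Or.inr (Or.inr (Or.inr (Or.inr (Or.inr (Or.inl (by linarith only [h]))))))
    · exact Or.inr (Or.inr (Or.inr (Or.inr (Or.inr (Or.inr (Or.inr (by linarith only [h])))))))
  · -- host b, Q = {1, 2}
    have h := hDEb 0 1 rfl rfl {1, 2}
    simp only [de_sumQ12, hv1, hv2] at h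
    rcases h with h | h | h | h | h | h | h | h
    · exact Or.inl (by linarith only [h])
    · exact Or.inr (Or.inr (Or.inl (by linarith only [h])))
    · exact Or.inr (Or.inr (Or.inr (Or.inr (Or.inl (by linarith only [h])))))
    · exact Or.inr (Or.inr (Or.inr (Or.inr (Or.inr (Or.inr (Or.inl (by linarith only [h])))))))
    · exact Or.inr (Or.inl (by linarith only [h]))
    · exact Or.inr (Or.inr (Or.inr (Or.inl (by linarith only [h]))))
    · exact Or.inr (Or.inr (Or.inr (Or.inr (Or.inr (Or.inl (by linarith only [h]))))))
    · exact Or.inr (Or.inr (Or.inr (Or.inr (Or.inr (Or.inr (Or.inr (by linarith only [h])))))))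
  · -- host b, Q = {1, 3}
    have h := hDEb 0 1 rfl rfl {1, 3}
    simp only [de_sumQ13, hv1, hv3] at h
    rcases h with h | h | h | h | h | h | h | h
    · exact Or.inl (by linarith only [h])
    · exact Or.inr (Or.inr (Or.inl (by linarith only [h])))
    · exact Or.inr (Or.inr (Or.inr (Or.inr (Or.inl (by linarith only [h])))))
    · exact Or.inr (Or.inr (Or.inr (Or.inr (Or.inr (Or.inr (Or.inl (by linarith only [h])))))))
    · exact Or.inr (Or.inl (by linarith only [h]))
    · exact Or.inr (Or.inr (Or.inr (Or.inl (by linarith only [h]))))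
    · exact Or.inr (Or.inr (Or.inr (Or.inr (Or.inr (Or.inl (by linarith only [h]))))))
    · exact Or.inr (Or.inr (Or.inr (Or.inr (Or.inr (Or.inr (Or.inr (by linarith only [h])))))))
  · -- host b, Q = {2, 3}
    have h := hDEb 0 1 rfl rfl {2, 3}
    simp only [de_sumQ23, hv2, hv3] at h
    rcases h with h | h | h | h | h | h | h | h
    · exact Or.inl (by linarith only [h])
    · exact Or.inr (Or.inr (Or.inl (by linarith only [h])))
    · exact Or.inr (Or.inr (Or.inr (Or.inr (Or.inl (by linarith only [h])))))
    · exact Or.inr (Or.inr (Or.inr (Or.inr (Or.inr (Or.inr (Or.inl (by linarith only [h])))))))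
    · exact Or.inr (Or.inl (by linarith only [h]))
    · exact Or.inr (Or.inr (Or.inr (Or.inl (by linarith only [h]))))
    · exact Or.inr (Or.inr (Or.inr (Or.inr (Or.inr (Or.inl (by linarith only [h]))))))
    · exact Or.inr (Or.inr (Or.inr (Or.inr (Or.inr (Or.inr (Or.inr (by linarith only [h])))))))
  · -- host b, Q = {1, 2, 3}
    have h := hDEb 0 1 rfl rfl {1, 2, 3}
    simp only [de_sumQ123, hv1, hv2, hv3] at h
    rcases h with h | h | h | h | h | h | h | h
    · exact Or.inl (by linarith only [h])
    · exact Or.inr (Or.inr (Or.inl (by linarith only [h])))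
    · exact Or.inr (Or.inr (Or.inr (Or.inr (Or.inl (by linarith only [h])))))
    · exact Or.inr (Or.inr (Or.inr (Or.inr (Or.inr (Or.inr (Or.inl (by linarith only [h])))))))
    · exact Or.inr (Or.inl (by linarith only [h]))
    · exact Or.inr (Or.inr (Or.inr (Or.inl (by linarith only [h]))))
    · exact Or.inr (Or.inr (Or.inr (Or.inr (Or.inr (Or.inl (by linarith only [h]))))))
    · exact Or.inr (Or.inr (Or.inr (Or.inr (Or.inr (Or.inr (Or.inr (by linarith only [h])))))))
  · -- host c, Q = {1}
    have h := hDEc 0 1 rfl rfl {1}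
    simp only [de_sumQ1, hv1] at h
    rcases h with h | h | h | h | h | h | h | h
    · exact Or.inl (by linarith only [h])
    · exact Or.inr (Or.inr (Or.inl (by linarith only [h])))
    · exact Or.inr (Or.inr (Or.inr (Or.inr (Or.inl (by linarith only [h])))))
    · exact Or.inr (Or.inr (Or.inr (Or.inr (Or.inr (Or.inr (Or.inl (by linarith only [h])))))))
    · exact Or.inr (Or.inl (by linarith only [h]))
    · exact Or.inr (Or.inr (Or.inr (Or.inl (by linarith only [h]))))
    · exact Or.inr (Or.inr (Or.inr (Or.inr (Or.inr (Or.inl (by linarith only [h]))))))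
    · exact Or.inr (Or.inr (Or.inr (Or.inr (Or.inr (Or.inr (Or.inr (by linarith only [h])))))))
  · -- host c, Q = {2}
    have h := hDEc 0 1 rfl rfl {2}
    simp only [de_sumQ2, hv2] at h
    rcases h with h | h | h | h | h | h | h | h
    · exact Or.inl (by linarith only [h])
    · exact Or.inr (Or.inr (Or.inl (by linarith only [h])))
    · exact Or.inr (Or.inr (Or.inr (Or.inr (Or.inl (by linarith only [h])))))
    · exact Or.inr (Or.inr (Or.inr (Or.inr (Or.inr (Or.inr (Or.inl (by linarith only [h])))))))
    · exact Or.inr (Or.inl (by linarith only [h]))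
    · exact Or.inr (Or.inr (Or.inr (Or.inl (by linarith only [h]))))
    · exact Or.inr (Or.inr (Or.inr (Or.inr (Or.inr (Or.inl (by linarith only [h]))))))
    · exact Or.inr (Or.inr (Or.inr (Or.inr (Or.inr (Or.inr (Or.inr (by linarith only [h])))))))
  · -- host c, Q = {3}
    have h := hDEc 0 1 rfl rfl {3}
    simp only [de_sumQ3, hv3] at h
    rcases h with h | h | h | h | h | h | h | h
    · exact Or.inl (by linarith only [h])
    · exact Or.inr (Or.inr (Or.inl (by linarith only [h])))
    · exact Or.inr (Or.inr (Or.inr (Or.inr (Or.inl (by linarith only [h])))))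
    · exact Or.inr (Or.inr (Or.inr (Or.inr (Or.inr (Or.inr (Or.inl (by linarith only [h])))))))
    · exact Or.inr (Or.inl (by linarith only [h]))
    · exact Or.inr (Or.inr (Or.inr (Or.inl (by linarith only [h]))))
    · exact Or.inr (Or.inr (Or.inr (Or.inr (Or.inr (Or.inl (by linarith only [h]))))))
    · exact Or.inr (Or.inr (Or.inr (Or.inr (Or.inr (Or.inr (Or.inr (by linarith only [h])))))))
  · -- host c, Q = {1, 2}
    have h := hDEc 0 1 rfl rfl {1, 2}
    simp only [de_sumQ12, hv1, hv2] at h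
    rcases h with h | h | h | h | h | h | h | h
    · exact Or.inl (by linarith only [h])
    · exact Or.inr (Or.inr (Or.inl (by linarith only [h])))
    · exact Or.inr (Or.inr (Or.inr (Or.inr (Or.inl (by linarith only [h])))))
    · exact Or.inr (Or.inr (Or.inr (Or.inr (Or.inr (Or.inr (Or.inl (by linarith only [h])))))))
    · exact Or.inr (Or.inl (by linarith only [h]))
    · exact Or.inr (Or.inr (Or.inr (Or.inl (by linarith only [h]))))
    · exact Or.inr (Or.inr (Or.inr (Or.inr (Or.inr (Or.inl (by linarith only [h]))))))
    · exact Or.inr (Or.inr (Or.inr (Or.inr (Or.inr (Or.inr (Or.inr (by linarith only [h])))))))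
  · -- host c, Q = {1, 3}
    have h := hDEc 0 1 rfl rfl {1, 3}
    simp only [de_sumQ13, hv1, hv3] at h
    rcases h with h | h | h | h | h | h | h | h
    · exact Or.inl (by linarith only [h])
    · exact Or.inr (Or.inr (Or.inl (by linarith only [h])))
    · exact Or.inr (Or.inr (Or.inr (Or.inr (Or.inl (by linarith only [h])))))
    · exact Or.inr (Or.inr (Or.inr (Or.inr (Or.inr (Or.inr (Or.inl (by linarith only [h])))))))
    · exact Or.inr (Or.inl (by linarith only [h]))
    · exact Or.inr (Or.inr (Or.inr (Or.inl (by linarith only [h]))))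
    · exact Or.inr (Or.inr (Or.inr (Or.inr (Or.inr (Or.inl (by linarith only [h]))))))
    · exact Or.inr (Or.inr (Or.inr (Or.inr (Or.inr (Or.inr (Or.inr (by linarith only [h])))))))
  · -- host c, Q = {2, 3}
    have h := hDEc 0 1 rfl rfl {2, 3}
    simp only [de_sumQ23, hv2, hv3] at h
    rcases h with h | h | h | h | h | h | h | h
    · exact Or.inl (by linarith only [h])
    · exact Or.inr (Or.inr (Or.inl (by linarith only [h])))
    · exact Or.inr (Or.inr (Or.inr (Or.inr (Or.inl (by linarith only [h])))))
    · exact Or.inr (Or.inr (Or.inr (Or.inr (Or.inr (Or.inr (Or.inl (by linarith only [h])))))))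
    · exact Or.inr (Or.inl (by linarith only [h]))
    · exact Or.inr (Or.inr (Or.inr (Or.inl (by linarith only [h]))))
    · exact Or.inr (Or.inr (Or.inr (Or.inr (Or.inr (Or.inl (by linarith only [h]))))))
    · exact Or.inr (Or.inr (Or.inr (Or.inr (Or.inr (Or.inr (Or.inr (by linarith only [h])))))))
  · -- host c, Q = {1, 2, 3}
    have h := hDEc 0 1 rfl rfl {1, 2, 3}
    simp only [de_sumQ123, hv1, hv2, hv3] at h
    rcases h with h | h | h | h | h | h | h | h
    · exact Or.inl (by linarith only [h])
    · exact Or.inr (Or.inr (Or.inl (by linarith only [h])))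
    · exact Or.inr (Or.inr (Or.inr (Or.inr (Or.inl (by linarith only [h])))))
    · exact Or.inr (Or.inr (Or.inr (Or.inr (Or.inr (Or.inr (Or.inl (by linarith only [h])))))))
    · exact Or.inr (Or.inl (by linarith only [h]))
    · exact Or.inr (Or.inr (Or.inr (Or.inl (by linarith only [h]))))
    · exact Or.inr (Or.inr (Or.inr (Or.inr (Or.inr (Or.inl (by linarith only [h]))))))
    · exact Or.inr (Or.inr (Or.inr (Or.inr (Or.inr (Or.inr (Or.inr (by linarith only [h])))))))

end Summit.ABC.ABC.Theorems.MazurKaneLaw
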